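import Mathlib
import HarnessLib
import Summits.HubbardSuperconductivity.HubbardSuperconductivity.Theorems.KLProgrammeKLRegimeTwoVolumeLipDoubledTruncDefs
import Summits.HubbardSuperconductivity.HubbardSuperconductivity.Theorems.KLProgrammeKLRegimeTwoVolumeLipDoubledTransferRows
import Summits.HubbardSuperconductivity.HubbardSuperconductivity.Theorems.KLProgrammeKLRegimeTwoVolumeLipProfilesOfTowerRate

/-!
# Route `KLProgramme` — crux K3 ENGINE (stmt-HubbardSuperconductivity-20437), stub (e) proof-input «(e)-D-ROWS», keying (A′), REKEY-D file D5T-p: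
# THE WEIGHTED PROFILES `NV`, `ND` OF THE TRUNCATED DOUBLED DOOR FROM THE MEASURED SIZES `klLipInputMeasDT … j_w` AT BOTH VOLUMES, and the degree-`0` rows
# (seat hubbard-kl-k3c4-p1 g28; truncated-doubled twin of ✓ `…TwoVolumeLipProfilesOfTowerRate`; `--supports` 23356)

* `sum_pinned_wt_norm_kernel_klGlueD_eq` — in the glued weight read through `Prod.fst`, the weighted pinned profile of `klGlueD W` at a fine pin is the
  `klScaleWt L`-weighted pinned profile of `W` at the residue pin (doubled twin of ✓ `sum_pinned_wt_norm_kernel_klGlue_eq`; `Lit/…Copies.sum_pinned_kernel_copies_sum`);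
* `glueD_wt_profile_le_measDT` — `hNV` with `NV m := ε·klLipInputMeasDT L … d k j_w m`; `fineDT_gluedWt_profile_le_measDT`; **`inputDiffDT_wt_profile_le_measDT`** — `hND` with
  `ND m := ε·(klLipInputMeasDT (bL) … + klLipInputMeasDT L …)`;
* `klLipInputMeasDT_zero`, `klLipInputDiffSupDT_deg_zero`, `klLipBornDiffSupDT_deg_zero` — the degree-`0` sizes vanish (empty slot type).

Compositions of landed theorems; nothing asserts the (D) rows, stub (e), VL, K3 or superconductivity.
References: BGM 2006 §2.8 (2.76)–(2.83), §3 [cite: BenfattoGiulianiMastropietro2006]; Salmhofer 1999 App. B.2 (B.23)–(B.25).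
-/

noncomputable section

namespace Summit.HubbardSuperconductivity.HubbardSuperconductivity.Theorems.TwoVolumeLip

set_option linter.dupNamespace false -- summit = problem name (single-conjunct summit), D-0017

open Finset Literature.MathematicalPhysics.QuantumLattice GrassmannAlgebra Literature.Probability.LatticeModels
  Literature.Probability.LatticeModels.BattleFederbush
open Literature.MathematicalPhysics.QuantumLattice.FermiRG
open Summit.HubbardSuperconductivity.HubbardSuperconductivity.Theorems.KLRegimeSplit
open Summit.HubbardSuperconductivity.HubbardSuperconductivity.Theorems.KLProgrammeLegKernels
open Summit.HubbardSuperconductivity.HubbardSuperconductivity.Theorems.DispersionFlow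
open Summit.HubbardSuperconductivity.HubbardSuperconductivity.Theorems.EngineV8
open Summit.HubbardSuperconductivity.HubbardSuperconductivity.Theorems.TwoVolumeSource
open Summit.HubbardSuperconductivity.HubbardSuperconductivity.Theorems.TwoVolumeDefect

/-! ## §1 The glued weight read through `Prod.fst`: weighted copies identity for the doubled glue -/

section GlueProfileD

variable {L b M : ℕ} [NeZero L] [NeZero (b * L)] [NeZero M] {n : ℕ}

omit [NeZero M] in
/-- **In the glued weight read through `Prod.fst`, the weighted pinned profile of `klGlueD W` at a fine pin is the `klScaleWt L`-weighted pinned profile of `W` at the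
residue pin** (doubled twin of ✓ `sum_pinned_wt_norm_kernel_klGlue_eq`). [cite: Salmhofer1999, App. B.2 (B.23)-(B.25)] -/
theorem sum_pinned_wt_norm_kernel_klGlueD_eq (β : ℝ) (J : ℕ) (W : GrassmannAlgebra ℂ (SrcLabel L M n)) {m : ℕ} (j : Fin m) (x' : SrcLabel (b * L) M n) :
    ∑ Y' ∈ univ.filter (fun Y' : Fin m → SrcLabel (b * L) M n => Y' j = x'),
        ‖kernel ℂ (klGlueD L b M n W) m Y'‖ * klGluedWt L b M β J (sectorCount n) ((univ.image Y').image Prod.fst) =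
      ∑ Y ∈ univ.filter (fun Y : Fin m → SrcLabel L M n => Y j = (klBlockEquivD L b M n x').2),
        ‖kernel ℂ W m Y‖ * klLabelWt (klScaleWt L M β J) ((univ.image Y).image Prod.fst) := by
  classical
  rw [klGlueD_def, sum_pinned_kernel_copies_sum (klBlockEquivD L b M n) (klBlockEmbD L b M n) klBlockEmbD_apply W j x'
    (fun Y' kk => ‖kk‖ * klGluedWt L b M β J (sectorCount n) ((univ.image Y').image Prod.fst)) (fun Y' => by rw [norm_zero, zero_mul])]
  refine sum_congr rfl fun Y _ => ?_
  congr 1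
  rw [klGluedWt, image_image, image_image, image_image]
  congr 1
  refine Finset.ext fun Z => ?_
  simp only [mem_image, mem_univ, true_and, Function.comp_apply, klBlockEquivD_symm_eq, klResLabel_symm_apply]

end GlueProfileD

/-! ## §2 The door's weighted profiles from the measured sizes at both volumes -/

section ProfilesDT

variable {L b M : ℕ} [NeZero L] [NeZero (b * L)] [NeZero M]

omit [NeZero M] in
/-- **`hNV` from the coarse measured size at rate `j_w`**: in the glued weight read through `Prod.fst` the pinned weighted profile of the doubled glue of the truncated coarse input
of block `k` is at most `ε · klLipInputMeasDT L … d k j_w m` (`0 ≤ β`). -/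
theorem glueD_wt_profile_le_measDT {β : ℝ} (hβ : 0 ≤ β) (U μ : ℝ) (K : TrigPolyC4v) (d k jw : ℕ) {m : ℕ} (j : Fin m) (x : SrcLabel (b * L) M (d * k - 1)) :
    ∑ Y ∈ univ.filter (fun Y : Fin m → SrcLabel (b * L) M (d * k - 1) => Y j = x),
        ‖kernel ℂ (klGlueD L b M (d * k - 1) (klLipInputDT L M β U μ K d k)) m Y‖ * klGluedWt L b M β jw (sectorCount (d * k - 1)) ((univ.image Y).image Prod.fst) ≤
      imagTimeWeight β M * klLipInputMeasDT L M β U μ K d k jw m := by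
  rw [sum_pinned_wt_norm_kernel_klGlueD_eq]
  exact sum_wt_norm_kernel_klLipInputDT_le hβ U μ K d k jw j _

omit [NeZero M] in
/-- **The fine truncated input in the glued weight at rate `j_w`**: `≤ ε · klLipInputMeasDT (bL) … d k j_w m` (the glued weight is at most the fine weight). -/
theorem fineDT_gluedWt_profile_le_measDT {β : ℝ} (hβ : 0 ≤ β) (U μ : ℝ) (K : TrigPolyC4v) (d k jw : ℕ) {m : ℕ} (j : Fin m) (x : SrcLabel (b * L) M (d * k - 1)) :
    ∑ Y ∈ univ.filter (fun Y : Fin m → SrcLabel (b * L) M (d * k - 1) => Y j = x),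
        ‖kernel ℂ (klLipInputDT (b * L) M β U μ K d k) m Y‖ * klGluedWt L b M β jw (sectorCount (d * k - 1)) ((univ.image Y).image Prod.fst) ≤
      imagTimeWeight β M * klLipInputMeasDT (b * L) M β U μ K d k jw m := by
  refine le_trans (sum_le_sum fun Y _ => mul_le_mul_of_nonneg_left (klGluedWt_le_klLabelWt_fine β jw ((univ.image Y).image Prod.fst)) (norm_nonneg _)) ?_
  exact sum_wt_norm_kernel_klLipInputDT_le hβ U μ K d k jw j x

/-- **`hND` from the two measured sizes at rate `j_w`**: in the glued weight read through `Prod.fst` the pinned weighted profile of the truncated input difference of block `k`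
is at most `ε · (klLipInputMeasDT (bL) … d k j_w m + klLipInputMeasDT L … d k j_w m)` (`0 ≤ β`). -/
theorem inputDiffDT_wt_profile_le_measDT {β : ℝ} (hβ : 0 ≤ β) (U μ : ℝ) (K : TrigPolyC4v) (d k jw : ℕ) {m : ℕ} (j : Fin m) (x : SrcLabel (b * L) M (d * k - 1)) :
    ∑ Y ∈ univ.filter (fun Y : Fin m → SrcLabel (b * L) M (d * k - 1) => Y j = x),
        ‖kernel ℂ (klLipInputDiffDT L b M β U μ K d k) m Y‖ * klGluedWt L b M β jw (sectorCount (d * k - 1)) ((univ.image Y).image Prod.fst) ≤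
      imagTimeWeight β M * (klLipInputMeasDT (b * L) M β U μ K d k jw m + klLipInputMeasDT L M β U μ K d k jw m) := by
  rw [klLipInputDiffDT_def, mul_add]
  exact sum_pinned_wt_norm_kernel_sub_le _ _ j x (fun S : Finset (SrcLabel (b * L) M (d * k - 1)) => klGluedWt L b M β jw (sectorCount (d * k - 1)) (S.image Prod.fst))
    (fun S => ((isTreeWeight_klGluedWt (L := L) (b := b) (M := M) hβ jw (sectorCount (d * k - 1))).comap Prod.fst).nonneg S)
    (fineDT_gluedWt_profile_le_measDT hβ U μ K d k jw j x) (glueD_wt_profile_le_measDT hβ U μ K d k jw j x)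

end ProfilesDT

/-! ## §3 Degree `0`: the measured size and the deep sups vanish -/

section DegZeroDT

variable {V L b M : ℕ} [NeZero V] [NeZero L] [NeZero (b * L)]

/-- The measured size vanishes in degree `0` (no slot). -/
theorem klLipInputMeasDT_zero (β U μ : ℝ) (K : TrigPolyC4v) (d k jw : ℕ) : klLipInputMeasDT V M β U μ K d k jw 0 = 0 := by
  unfold klLipInputMeasDT
  haveI : IsEmpty (Fin 0 × SrcLabel V M (d * k - 1)) := by infer_instance
  rw [Real.iSup_of_isEmpty]

/-- The ungraded input-difference sup vanishes in degree `0`. -/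
theorem klLipInputDiffSupDT_deg_zero (β U μ : ℝ) (K : TrigPolyC4v) (d k R : ℕ) : klLipInputDiffSupDT L b M β U μ K d k 0 R = 0 := by
  unfold klLipInputDiffSupDT
  haveI : IsEmpty (Fin 0 × {w : SrcLabel (b * L) M (d * k - 1) // w ∈ klDeepPinsD (V := b * L) (M := M) (n := d * k - 1) L R}) := by infer_instance
  exact Real.iSup_of_isEmpty _

/-- The ungraded born-difference sup vanishes in degree `0`. -/
theorem klLipBornDiffSupDT_deg_zero (β U μ : ℝ) (K : TrigPolyC4v) (d k R : ℕ) : klLipBornDiffSupDT L b M β U μ K d k 0 R = 0 := by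
  unfold klLipBornDiffSupDT
  haveI : IsEmpty (Fin 0 × {w : SrcLabel (b * L) M (d * k) // w ∈ klDeepPinsD (V := b * L) (M := M) (n := d * k) L R}) := by infer_instance
  exact Real.iSup_of_isEmpty _

end DegZeroDT

end Summit.HubbardSuperconductivity.HubbardSuperconductivity.Theorems.TwoVolumeLip

end
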